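import Mathlib
import Literature.RepresentationTheory.FiniteGroups.IrreducibleCharacters
import Summits.MatrixMultiplication.MatrixMultiplication.Theorems.LieRankDesigns.Negative.Basics

/-!
# Graded budget of a direct power (stub `stub_powerBudget` of line `Sketch`,
# crux `LevelGradedCohnUmans.GradedDesignFamily`)

For a finite group `G`, a subspace `J ≤ ℂ^G` and a real exponent `s`, the *graded budget* of a
set `S ⊆ ℂ^G` is `Σᶠ_{χ ∈ Irr G ∩ S} χ(1)^s`.  For the direct power `κ → G` and the test space
`J^{⊠κ} = span{h ↦ Π_k g_k (h k) : g_k ∈ J}` we prove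
`budget(κ → G, J^{⊠κ}, s) ≤ budget(G, J, s)^{|κ|}`, *given* the binary inequality
`budget(K × L, J_K ⊠ J_L, s) ≤ budget(K, J_K, s) · budget(L, J_L, s)` for all finite groups
(hypothesis `hprod`).  Proof: graded budgets are monotone under transport along group
isomorphisms (`χ ↦ χ ∘ e` maps irreducible characters to irreducible characters); split
`Fin (n+1) → G ≃* G × (Fin n → G)` and induct on `n`; the power over `Fin 0` is the trivial
group, whose only irreducible character is `1`; finally reindex `κ ≃ Fin |κ|`.
-/

noncomputable section

set_option linter.dupNamespace false

open scoped BigOperators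
open Literature.RepresentationTheory.FiniteGroups
open Summit.MatrixMultiplication.MatrixMultiplication.Theorems.LieRankDesigns.Negative
  (re_apply_one_nonneg)

namespace Summit.MatrixMultiplication.MatrixMultiplication.Theorems.GradedDesignFamily

/-! ## Non-negativity and monotonicity of finite sums of degrees -/

/-- The graded budget `Σᶠ_{χ ∈ Irr G ∩ S} χ(1)^s` is non-negative (degrees are non-negative,
`re_apply_one_nonneg`). -/
theorem powerBudget_nonneg {G : Type} [Group G] (S : Set (G → ℂ)) (s : ℝ) :
    0 ≤ ∑ᶠ χ ∈ irrChars G ∩ S, (χ 1).re ^ s :=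
  finsum_nonneg fun _ => finsum_nonneg fun hχ =>
    Real.rpow_nonneg (re_apply_one_nonneg hχ.1) s

/-- A finite sum of non-negative reals over a set is monotone in the set. -/
theorem powerBudget_finsum_mem_mono {α : Type*} {A B : Set α} (hB : B.Finite) (hAB : A ⊆ B)
    {f : α → ℝ} (hf : ∀ x ∈ B, 0 ≤ f x) : ∑ᶠ x ∈ A, f x ≤ ∑ᶠ x ∈ B, f x := by
  rw [finsum_mem_eq_finite_toFinset_sum f hB, finsum_mem_eq_finite_toFinset_sum f (hB.subset hAB)]
  exact Finset.sum_le_sum_of_subset_of_nonneg (Set.Finite.toFinset_subset_toFinset.mpr hAB)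
    fun x hx _ => hf x (hB.mem_toFinset.mp hx)

/-! ## Transport along group isomorphisms -/

/-- `χ ∘ e` is an irreducible character of `G₂` if `χ` is an irreducible character of `G₁` and
`e : G₂ ≃* G₁` (the invariant subspaces of `ρ ∘ e` are those of `ρ`). -/
theorem powerBudget_isIrrChar_comp {G₁ G₂ : Type} [Group G₁] [Group G₂] {χ : G₁ → ℂ}
    (hχ : IsIrrChar G₁ χ) (e : G₂ ≃* G₁) : IsIrrChar G₂ (χ ∘ e) := by
  obtain ⟨W, _, _, _, σ, hσ, rfl⟩ := hχ
  refine ⟨W, _, _, inferInstance, σ.comp e.toMonoidHom, ?_, rfl⟩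
  haveI := hσ
  let f : Subrepresentation (σ.comp e.toMonoidHom) ≃o Subrepresentation σ :=
    { toFun := fun p => ⟨p.toSubmodule, fun g v hv => by
        have := p.apply_mem_toSubmodule (e.symm g) hv
        simpa using this⟩
      invFun := fun p => ⟨p.toSubmodule, fun g v hv => p.apply_mem_toSubmodule (e g) hv⟩
      left_inv := fun p => by ext; rfl
      right_inv := fun p => by ext; rfl
      map_rel_iff' := Iff.rfl }
  exact f.isSimpleOrder

/-- **Transport.** If `e : G₂ ≃* G₁` maps every generator of `S` into `T` (`F ↦ F ∘ e`), then the
graded budget of `span S` in `G₁` is at most the graded budget of `span T` in `G₂`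
(`χ ↦ χ ∘ e` is injective, preserves irreducibility and the degree). -/
theorem powerBudget_transport {G₁ G₂ : Type} [Group G₁] [Finite G₁] [Group G₂] [Finite G₂]
    (e : G₂ ≃* G₁) {S : Set (G₁ → ℂ)} {T : Set (G₂ → ℂ)} (hST : ∀ F ∈ S, F ∘ e ∈ T) (s : ℝ) :
    ∑ᶠ χ ∈ irrChars G₁ ∩ (Submodule.span ℂ S : Set (G₁ → ℂ)), (χ 1).re ^ s ≤
      ∑ᶠ χ ∈ irrChars G₂ ∩ (Submodule.span ℂ T : Set (G₂ → ℂ)), (χ 1).re ^ s := by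
  have hinj : Set.InjOn (fun χ : G₁ → ℂ => χ ∘ e)
      (irrChars G₁ ∩ (Submodule.span ℂ S : Set (G₁ → ℂ))) := fun χ _ χ' _ h => by
    funext x
    have := congrFun h (e.symm x)
    simpa using this
  have hle : Submodule.span ℂ S ≤ (Submodule.span ℂ T).comap (LinearMap.funLeft ℂ ℂ e) :=
    Submodule.span_le.mpr fun F hF => Submodule.subset_span (hST F hF)
  have himage : (fun χ : G₁ → ℂ => χ ∘ e) '' (irrChars G₁ ∩ (Submodule.span ℂ S : Set (G₁ → ℂ)))
      ⊆ irrChars G₂ ∩ (Submodule.span ℂ T : Set (G₂ → ℂ)) := by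
    rintro _ ⟨χ, ⟨hχ, hχS⟩, rfl⟩
    exact ⟨powerBudget_isIrrChar_comp hχ e, hle hχS⟩
  have key : ∑ᶠ χ ∈ irrChars G₁ ∩ (Submodule.span ℂ S : Set (G₁ → ℂ)), (χ 1).re ^ s =
      ∑ᶠ ψ ∈ (fun χ : G₁ → ℂ => χ ∘ e) '' (irrChars G₁ ∩ (Submodule.span ℂ S : Set (G₁ → ℂ))),
        (ψ 1).re ^ s := by
    rw [finsum_mem_image hinj]
    exact finsum_mem_congr rfl fun χ _ => by simp only [Function.comp_apply, map_one]
  rw [key]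
  exact powerBudget_finsum_mem_mono ((irrChars_finite_holds G₂).subset Set.inter_subset_left)
    himage fun _ hχ => Real.rpow_nonneg (re_apply_one_nonneg hχ.1) s

/-! ## The trivial group -/

/-- An irreducible character of a trivial group is the constant `1` (irreducible
representations of abelian groups are one-dimensional). -/
theorem powerBudget_irrChar_eq_of_subsingleton {U : Type} [Group U] [Subsingleton U]
    {χ : U → ℂ} (hχ : IsIrrChar U χ) : χ = fun _ => 1 := by
  obtain ⟨V, _, _, _, ρ, hρ, rfl⟩ := hχ
  haveI := hρ
  haveI : IsMulCommutative U := ⟨⟨fun a b => Subsingleton.elim _ _⟩⟩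
  have h1 : Module.finrank ℂ V = 1 :=
    Representation.IsIrreducible.finrank_eq_one_of_isMulCommutative ρ
  funext g
  rw [Subsingleton.elim g 1, Representation.char_one, h1, Nat.cast_one]

/-- The graded budget of any set of functions on a trivial group is at most `1`. -/
theorem powerBudget_le_one_of_subsingleton {U : Type} [Group U] [Subsingleton U]
    (S : Set (U → ℂ)) (s : ℝ) : ∑ᶠ χ ∈ irrChars U ∩ S, (χ 1).re ^ s ≤ 1 := by
  have hsub : irrChars U ∩ S ⊆ {fun _ => 1} := fun χ hχ =>
    powerBudget_irrChar_eq_of_subsingleton hχ.1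
  calc ∑ᶠ χ ∈ irrChars U ∩ S, (χ 1).re ^ s
      ≤ ∑ᶠ χ ∈ ({fun _ => (1 : ℂ)} : Set (U → ℂ)), (χ 1).re ^ s :=
        powerBudget_finsum_mem_mono (Set.finite_singleton _) hsub fun χ hχ => by
          rw [Set.mem_singleton_iff] at hχ
          subst hχ
          simp only [Complex.one_re, Real.one_rpow, zero_le_one]
    _ = 1 := by
        rw [finsum_mem_singleton]
        simp only [Complex.one_re, Real.one_rpow]

/-! ## Induction on the number of factors -/

/-- `budget(Fin n → G, J^{⊠ Fin n}, s) ≤ budget(G, J, s)^n`, by induction on `n` along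
`G × (Fin n → G) ≃* (Fin (n+1) → G)`, given the binary product inequality `hprod`. -/
theorem powerBudget_fin {G : Type} [Group G] [Fintype G] [DecidableEq G]
    (J : Submodule ℂ (G → ℂ)) (s : ℝ)
    (hprod : ∀ (K L : Type) [Group K] [Fintype K] [DecidableEq K] [Group L] [Fintype L]
      [DecidableEq L] (JK : Submodule ℂ (K → ℂ)) (JL : Submodule ℂ (L → ℂ)),
      (∑ᶠ χ ∈ irrChars (K × L) ∩ (Submodule.span ℂ {F : K × L → ℂ | ∃ f ∈ JK, ∃ g ∈ JL,
          F = fun p => f p.1 * g p.2} : Set (K × L → ℂ)), (χ 1).re ^ s) ≤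
        (∑ᶠ χ ∈ irrChars K ∩ (JK : Set (K → ℂ)), (χ 1).re ^ s) *
          (∑ᶠ χ ∈ irrChars L ∩ (JL : Set (L → ℂ)), (χ 1).re ^ s)) (n : ℕ) :
    (∑ᶠ χ ∈ irrChars (Fin n → G) ∩ (Submodule.span ℂ {F : (Fin n → G) → ℂ |
        ∃ g : Fin n → (G → ℂ), (∀ k, g k ∈ J) ∧ F = fun h => ∏ k, g k (h k)} :
          Set ((Fin n → G) → ℂ)), (χ 1).re ^ s) ≤
      (∑ᶠ χ ∈ irrChars G ∩ (J : Set (G → ℂ)), (χ 1).re ^ s) ^ n := by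
  induction n with
  | zero =>
    rw [pow_zero]
    exact powerBudget_le_one_of_subsingleton _ s
  | succ n ih =>
    -- the splitting isomorphism `G × (Fin n → G) ≃* (Fin (n+1) → G)`, `(x, h) ↦ Fin.cons x h`
    let e : G × (Fin n → G) ≃* (Fin (n + 1) → G) :=
      MulEquiv.mk' (Fin.consEquiv fun _ : Fin (n + 1) => G) fun a b => by
        funext i
        refine Fin.cases ?_ (fun j => ?_) i
        · simp only [Fin.consEquiv_apply, Pi.mul_apply, Fin.cons_zero, Prod.fst_mul]
        · simp only [Fin.consEquiv_apply, Pi.mul_apply, Fin.cons_succ, Prod.snd_mul]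
    have he : ∀ p : G × (Fin n → G), e p = Fin.cons p.1 p.2 := fun p => rfl
    -- the smaller power test space
    set Jn : Submodule ℂ ((Fin n → G) → ℂ) := Submodule.span ℂ {F : (Fin n → G) → ℂ |
        ∃ g : Fin n → (G → ℂ), (∀ k, g k ∈ J) ∧ F = fun h => ∏ k, g k (h k)}
    have htrans := powerBudget_transport e
      (S := {F : (Fin (n + 1) → G) → ℂ |
        ∃ g : Fin (n + 1) → (G → ℂ), (∀ k, g k ∈ J) ∧ F = fun h => ∏ k, g k (h k)})
      (T := {F : G × (Fin n → G) → ℂ | ∃ f ∈ J, ∃ g ∈ Jn, F = fun p => f p.1 * g p.2})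
      (by
        rintro _ ⟨g, hg, rfl⟩
        refine ⟨g 0, hg 0, fun h => ∏ k : Fin n, g k.succ (h k),
          Submodule.subset_span ⟨fun k => g k.succ, fun k => hg k.succ, rfl⟩, ?_⟩
        funext p
        simp only [Function.comp_apply, he, Fin.prod_univ_succ, Fin.cons_zero, Fin.cons_succ]) s
    refine htrans.trans ((hprod G (Fin n → G) J Jn).trans ?_)
    rw [pow_succ']
    exact mul_le_mul_of_nonneg_left ih (powerBudget_nonneg _ s)

/-! ## The stub -/

/-- **Stub 3 — graded budget of a direct power from the binary inequality.**  For the power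
group `κ → G` and the test space `J^{⊠κ} = span{h ↦ Π_k g_k (h k) : g_k ∈ J}`,
`Σᶠ_{χ ∈ Irr(G^κ) ∩ J^{⊠κ}} χ(1)^s ≤ (Σᶠ_{χ ∈ Irr G ∩ J} χ(1)^s)^{|κ|}`, given the binary product
inequality `hprod`; reindex `κ ≃ Fin |κ|` and induct (graded form of the direct-power step in
the proof of [cite: CohnKleinbergSzegedyUmans2005, Thm. 7.1]). -/
theorem stub_powerBudget {G : Type} [Group G] [Fintype G] [DecidableEq G] {κ : Type} [Fintype κ]
    [DecidableEq κ] (J : Submodule ℂ (G → ℂ)) (s : ℝ)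
    (hprod : ∀ (K L : Type) [Group K] [Fintype K] [DecidableEq K] [Group L] [Fintype L]
      [DecidableEq L] (JK : Submodule ℂ (K → ℂ)) (JL : Submodule ℂ (L → ℂ)),
      (∑ᶠ χ ∈ irrChars (K × L) ∩ (Submodule.span ℂ {F : K × L → ℂ | ∃ f ∈ JK, ∃ g ∈ JL,
          F = fun p => f p.1 * g p.2} : Set (K × L → ℂ)), (χ 1).re ^ s) ≤
        (∑ᶠ χ ∈ irrChars K ∩ (JK : Set (K → ℂ)), (χ 1).re ^ s) *
          (∑ᶠ χ ∈ irrChars L ∩ (JL : Set (L → ℂ)), (χ 1).re ^ s)) :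
    (∑ᶠ χ ∈ irrChars (κ → G) ∩ (Submodule.span ℂ {F : (κ → G) → ℂ | ∃ g : κ → (G → ℂ),
        (∀ k, g k ∈ J) ∧ F = fun h => ∏ k, g k (h k)} : Set ((κ → G) → ℂ)), (χ 1).re ^ s) ≤
      (∑ᶠ χ ∈ irrChars G ∩ (J : Set (G → ℂ)), (χ 1).re ^ s) ^ Fintype.card κ := by
  -- reindex `κ ≃ Fin |κ|`
  let eκ : κ ≃ Fin (Fintype.card κ) := Fintype.equivFin κ
  let e : (Fin (Fintype.card κ) → G) ≃* (κ → G) := MulEquiv.arrowCongr eκ.symm (MulEquiv.refl G)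
  have he : ∀ (h : Fin (Fintype.card κ) → G) (k : κ), e h k = h (eκ k) := fun h k => rfl
  refine (powerBudget_transport e
    (T := {F : (Fin (Fintype.card κ) → G) → ℂ | ∃ g : Fin (Fintype.card κ) → (G → ℂ),
      (∀ k, g k ∈ J) ∧ F = fun h => ∏ k, g k (h k)}) ?_ s).trans
    (powerBudget_fin J s hprod (Fintype.card κ))
  rintro _ ⟨g, hg, rfl⟩
  refine ⟨fun i => g (eκ.symm i), fun i => hg _, ?_⟩
  funext h
  simp only [Function.comp_apply, he]
  exact Fintype.prod_equiv eκ _ _ fun k => by rw [Equiv.symm_apply_apply]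

end Summit.MatrixMultiplication.MatrixMultiplication.Theorems.GradedDesignFamily

end
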